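import Summits.CriticalPhenomena.SAWScalingLimit.Theorems.SAWLeftRightFKGFKGToTraversalBoundOutlineTour
import HarnessLib

/-!
# Wall-follower tour of a lattice site set: a tour arc as a lattice walk with contacts

Crux `SAWLeftRightFKG.FKGToTraversalBound` (stmt-CriticalPhenomena-1878), line `slit-necklace`, lead
prover-line-stmt-CriticalPhenomena-1878-c5-0; witness unit U1-c (wall-follower tour), on top of the vocabulary
`…SlitNecklaceOutline` (`ODir`, `IsBEdge`, `bnext`, `btour`, `bsite`, `bcontact`) and the one-step geometry
`bnext_step` / `bnext_cases` of `…OutlineTour`.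

* `exists_walk_bnext` — one step of the tour as a lattice walk of length `≤ 2` inside `A` from the outline
  site of a boundary edge to the outline site of its successor; every vertex after the first is within
  sup-distance `1` of the contact site of the successor;
* `btour_arcWalk` (registered) — concatenating these: the arc `btour m, …, btour n` of the tour is traced by
  a lattice walk inside `A` from `bsite (btour m)` to `bsite (btour n)` together with a MONOTONE assignment
  `φ` of tour indices in `[m, n]` to its vertices, each vertex within sup-distance `1` of the contact site of
  its assigned tour edge.

All statements folklore ("wall follower" / boundary tracing of a polyomino); no literature fact; nothing
restates the crux.
-/

noncomputable section

open Literature.Probability.LatticeModels SimpleGraph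

namespace Summit.CriticalPhenomena.SAWScalingLimit.Theorems.FKGToTraversalBound.SlitNecklace

/-- **One step of the tour as a short lattice walk.**  From the outline site of the boundary edge `e` to the
outline site of its successor there is a lattice walk inside `A` (of length `0`, `1` or `2` according to the
three cases of `bnext`) all of whose vertices after the first are within sup-distance `1` of the contact
site of the successor. [folklore] -/
theorem exists_walk_bnext (A : Set (Site 2)) (e : Site 2 × ODir) (he : IsBEdge A e) :
    ∃ q : (zdGraph 2).Walk (bsite e) (bsite (bnext A e)), (∀ z ∈ q.support, z ∈ A) ∧
      ∀ j, 0 < j → ∀ i : Fin 2, |(q.getVert j - bcontact (bnext A e)) i| ≤ 1 := by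
  obtain ⟨x, d⟩ := e
  obtain ⟨hx, -⟩ := he
  simp only at hx
  rcases bnext_cases A x d with ⟨-, h⟩ | ⟨ha, -, h⟩ | ⟨ha, ho, h⟩
  · -- convex corner: the outline site stays
    rw [h]
    simp only [bsite, bcontact]
    refine ⟨Walk.nil, ?_, fun j _ i => ?_⟩
    · intro z hz
      rw [Walk.support_nil, List.mem_singleton] at hz
      rw [hz]
      exact hx
    · rw [Walk.getVert_nil]
      have : x - (x + d.ccw.vec) = -d.ccw.vec := by abel
      rw [this, Pi.neg_apply, abs_neg]
      exact ODir.abs_vec_apply_le d.ccw i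
  · -- flat boundary: one lattice edge
    rw [h]
    simp only [bsite, bcontact]
    refine ⟨Walk.cons (ODir.adj_add_vec x d.ccw) Walk.nil, ?_, fun j hj i => ?_⟩
    · intro z hz
      rw [Walk.support_cons, Walk.support_nil, List.mem_cons, List.mem_singleton] at hz
      rcases hz with rfl | rfl
      · exact hx
      · exact ha
    · obtain ⟨j, rfl⟩ := Nat.exists_eq_add_one_of_ne_zero hj.ne'
      rw [Walk.getVert_cons_succ, Walk.getVert_nil]
      have : x + d.ccw.vec - (x + d.ccw.vec + d.vec) = -d.vec := by abel
      rw [this, Pi.neg_apply, abs_neg]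
      exact ODir.abs_vec_apply_le d i
  · -- reflex corner: two lattice edges through the pixel ahead
    rw [h]
    have h₂ : (zdGraph 2).Adj (x + d.ccw.vec) (bsite (x + d.vec + d.ccw.vec, d.cw)) :=
      (add_right_comm x d.ccw.vec d.vec) ▸ ODir.adj_add_vec (x + d.ccw.vec) d
    have hc : bcontact (x + d.vec + d.ccw.vec, d.cw) = x + d.vec := by
      simp only [bcontact]; rw [ODir.vec_cw]; abel
    refine ⟨Walk.cons (ODir.adj_add_vec x d.ccw) (Walk.cons h₂ Walk.nil), ?_, fun j hj i => ?_⟩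
    · intro z hz
      rw [Walk.support_cons, Walk.support_cons, Walk.support_nil, List.mem_cons, List.mem_cons,
        List.mem_singleton] at hz
      rcases hz with rfl | rfl | rfl
      · exact hx
      · exact ha
      · exact ho
    · obtain ⟨j, rfl⟩ := Nat.exists_eq_add_one_of_ne_zero hj.ne'
      rw [Walk.getVert_cons_succ, hc]
      rcases j with _ | j
      · rw [Walk.getVert_zero]
        have : x + d.ccw.vec - (x + d.vec) = d.ccw.vec - d.vec := by abel
        rw [this]
        exact ODir.abs_vec_ccw_sub_vec_apply_le d i
      · rw [Walk.getVert_cons_succ, Walk.getVert_nil]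
        have : bsite (x + d.vec + d.ccw.vec, d.cw) - (x + d.vec) = d.ccw.vec := by
          simp only [bsite]; abel
        rw [this]
        exact ODir.abs_vec_apply_le d.ccw i

/-- On an initial segment, the vertices of `p.append q` are those of `p`. [folklore] -/
private theorem getVert_append_of_le_length {V : Type*} {G : SimpleGraph V} {u v w : V} (p : G.Walk u v)
    (q : G.Walk v w) {k : ℕ} (hk : k ≤ p.length) : (p.append q).getVert k = p.getVert k := by
  rw [Walk.getVert_append]
  split_ifs with h
  · rfl
  · obtain rfl : k = p.length := le_antisymm hk (not_lt.1 h)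
    rw [Nat.sub_self, Walk.getVert_zero, Walk.getVert_length]

/-- **Registered stub (witness unit U1-c): a tour arc as a lattice walk in `A` with a monotone contact
assignment.**  For `m ≤ n`, the outline sites `bsite (btour m), …, bsite (btour n)` of the tour of a boundary
edge are joined, in order, by a lattice walk inside `A`, and its vertices carry a monotone assignment `φ` of
tour indices in `[m, n]` such that every vertex is within sup-distance `1` of the contact site of its assigned
tour edge.  Induction on `n`, appending the walk of `exists_walk_bnext` and assigning the new index to the new
vertices. [folklore] -/
theorem btour_arcWalk : ∀ (A : Set (Site 2)) (e₀ : Site 2 × ODir) (m n : ℕ), IsBEdge A e₀ → m ≤ n → ∃ (p : (zdGraph 2).Walk (bsite (btour A e₀ m)) (bsite (btour A e₀ n))) (φ : ℕ → ℕ), (∀ z ∈ p.support, z ∈ A) ∧ Monotone φ ∧ ∀ k, k ≤ p.length → m ≤ φ k ∧ φ k ≤ n ∧ ∀ i : Fin 2, |(p.getVert k - bcontact (btour A e₀ (φ k))) i| ≤ 1 := by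
  intro A e₀ m n h₀ hmn
  induction n, hmn using Nat.le_induction with
  | base =>
    refine ⟨Walk.nil, fun _ => m, ?_, monotone_const, fun k _ => ⟨le_rfl, le_rfl, fun i => ?_⟩⟩
    · intro z hz
      rw [Walk.support_nil, List.mem_singleton] at hz
      rw [hz]
      exact (btour_isBEdge A h₀ m).1
    · rw [Walk.getVert_nil]
      have : bsite (btour A e₀ m) - bcontact (btour A e₀ m) = -(btour A e₀ m).2.vec := by
        simp only [bsite, bcontact]; abel
      rw [this, Pi.neg_apply, abs_neg]
      exact ODir.abs_vec_apply_le _ i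
  | succ n hmn ih =>
    obtain ⟨p, φ, hsupp, hmono, hinv⟩ := ih
    obtain ⟨q, hqsupp, hq⟩ := exists_walk_bnext A (btour A e₀ n) (btour_isBEdge A h₀ n)
    have hend : bsite (bnext A (btour A e₀ n)) = bsite (btour A e₀ (n + 1)) := by
      rw [btour_succ]
    refine ⟨(p.append q).copy rfl hend, fun k => if k ≤ p.length then φ k else n + 1, ?_, ?_, ?_⟩
    · -- support inside `A`
      intro z hz
      rw [Walk.support_copy, Walk.mem_support_append_iff] at hz
      rcases hz with hz | hz
      · exact hsupp z hz
      · exact hqsupp z hz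
    · -- monotone assignment
      intro a b hab
      dsimp only
      by_cases hb : b ≤ p.length
      · rw [if_pos (hab.trans hb), if_pos hb]
        exact hmono hab
      · rw [if_neg hb]
        split_ifs with ha
        · exact (hinv a ha).2.1.trans (Nat.le_succ n)
        · exact le_rfl
    · -- the contact assignment
      intro k hk
      rw [Walk.length_copy, Walk.length_append] at hk
      rw [Walk.getVert_copy]
      dsimp only
      by_cases hkp : k ≤ p.length
      · rw [if_pos hkp, getVert_append_of_le_length p q hkp]
        obtain ⟨h1, h2, h3⟩ := hinv k hkp
        exact ⟨h1, h2.trans (Nat.le_succ n), h3⟩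
      · rw [if_neg hkp, Walk.getVert_append, if_neg (fun h => hkp h.le), btour_succ]
        exact ⟨hmn.trans (Nat.le_succ n), le_rfl, hq (k - p.length) (by omega)⟩

end Summit.CriticalPhenomena.SAWScalingLimit.Theorems.FKGToTraversalBound.SlitNecklace

end
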